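import Literature.Computability.Complexity.GabberGalilZ2
import Literature.Computability.Complexity.GabberGalilFourier
import HarnessLib

/-!
# Gabber–Galil, third step: unwrapping the torus onto `ℤ²` (the low-frequency window)

With `g ≥ 0` on `(ℤ/n)²`, `g(0) = 0` (in the application `g = ‖F‖`, `F` the transform of an `f ⊥ 1`),
this file proves the core inequality of the tree's discrete version of Lee's argument (Lee 2013, §2,
where the continuous torus is used instead):

  `∑_z g(z)² ≤ (32 / c₁) · N'(g)`,  `N'(g) = ∑_z w(z) g(z)² + (g(S'z) - g z)² + (g(T'z) - g z)²`,

`c₁ = 2 - 2cos(π/8)`.  Proof: on the window `R = {z ≠ 0 : 8|z̄₁| < n, 8|z̄₂| < n}` (centred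
representatives) the dual shears do not wrap around, so `h = g·1_R` transported to `ℤ²` has
`∑_R g² ≤ 8 · energy(h)` (`GabberGalilZ2.sum_sq_le_eight_mul_energy`); the energy of `h` is at most
the shear part of `N'(g)` plus `4 ∑_{R ∖ tiny} g²` (`tiny`: `16|z̄ᵢ| < n`), boundary effects only; and off
`tiny` the multiplier `w(z) ≥ c₁` because a coordinate `z̄ᵢ` has `2π|z̄ᵢ|/n ∈ [π/8, π]`.

* `c₁`, `c₁_pos`, `c₁_ge` (`c₁ ≥ 3/20`, from `cos(π/8) = √(2+√2)/2`);
* `wt_ge_c₁` — the multiplier bound off the tiny window;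
* **`sum_sq_le_mul_energyF`** — the inequality above.

## References

* J. R. Lee, *On expanders from the action of GL(2,ℤ)*, arXiv:1301.6296 (2013), §2.
* S. Hoory, N. Linial, A. Wigderson, Bull. AMS 43 (2006), §8.2 (the discrete analysis).
-/

noncomputable section

namespace Literature.Computability.Complexity

open Finset

namespace GabberGalil

/-! ### The constant `c₁ = 2 - 2 cos(π/8)` -/

/-- `c₁ = 2 - 2 cos(π/8)`. [folklore] -/
def c₁ : ℝ := 2 - 2 * Real.cos (Real.pi / 8)

/-- `cos(π/8) ≤ 37/40`. [folklore] -/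
theorem cos_pi_div_eight_le : Real.cos (Real.pi / 8) ≤ 37 / 40 := by
  rw [Real.cos_pi_div_eight]
  have h2 : Real.sqrt 2 ≤ 1.4143 := by
    rw [show (1.4143 : ℝ) = Real.sqrt (1.4143 ^ 2) by rw [Real.sqrt_sq (by norm_num)]]
    exact Real.sqrt_le_sqrt (by norm_num)
  have h3 : Real.sqrt (2 + Real.sqrt 2) ≤ 1.848 := by
    rw [show (1.848 : ℝ) = Real.sqrt (1.848 ^ 2) by rw [Real.sqrt_sq (by norm_num)]]
    exact Real.sqrt_le_sqrt (by linarith)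
  linarith

/-- `c₁ ≥ 3/20`. [folklore] -/
theorem c₁_ge : (3 : ℝ) / 20 ≤ c₁ := by unfold c₁; linarith [cos_pi_div_eight_le]

/-- `c₁ > 0`. [folklore] -/
theorem c₁_pos : 0 < c₁ := lt_of_lt_of_le (by norm_num) c₁_ge

/-- `c₁ ≤ 4`. [folklore] -/
theorem c₁_le : c₁ ≤ 4 := by unfold c₁; linarith [Real.neg_one_le_cos (Real.pi / 8)]

variable {n : ℕ} [NeZero n]

/-! ### Centred representatives and the windows -/

/-- The centred representative of a residue. [folklore] -/
abbrev vm (a : ZMod n) : ℤ := a.valMinAbs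

/-- `small k z`: both centred coordinates have `k |z̄ᵢ| < n`. [folklore] -/
def small (k : ℕ) (z : ZMod n × ZMod n) : Prop := (vm z.1).natAbs * k < n ∧ (vm z.2).natAbs * k < n

/-- Smallness is decidable. [folklore] -/
instance (k : ℕ) (z : ZMod n × ZMod n) : Decidable (small k z) := by unfold small; infer_instance

omit [NeZero n] in
/-- Smallness is monotone in the constant. [folklore] -/
theorem small.mono {k k' : ℕ} (hk : k ≤ k') {z : ZMod n × ZMod n} (h : small k' z) : small k z :=
  ⟨lt_of_le_of_lt (Nat.mul_le_mul_left _ hk) h.1, lt_of_le_of_lt (Nat.mul_le_mul_left _ hk) h.2⟩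

/-- The multiplier of a coordinate that is not tiny is at least `c₁`. [cite: Lee2013GL2Z, §2 (the translation edges)] -/
theorem normSq_ψ_sub_one_ge {a : ZMod n} (h : n ≤ (vm a).natAbs * 16) : c₁ ≤ ‖(ψ a : ℂ) - 1‖ ^ 2 := by
  rw [normSq_ψ_sub_one, c₁]
  have hnpos : (0 : ℝ) < n := by exact_mod_cast Nat.pos_of_ne_zero (NeZero.ne n)
  obtain ⟨k, hk⟩ : ∃ k : ℕ, k = (vm a).natAbs := ⟨_, rfl⟩
  rw [← hk] at h
  -- the cosine only sees `|ā| = k`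
  have hkabs : |((vm a : ℤ) : ℝ)| = (k : ℝ) := by
    rw [hk, Nat.cast_natAbs, Int.cast_abs]
  have hcos_eq : Real.cos (2 * Real.pi * (a.valMinAbs : ℝ) / n) = Real.cos (2 * Real.pi * k / n) := by
    rw [← Real.cos_abs, abs_div, abs_mul, abs_of_pos (by positivity : (0 : ℝ) < 2 * Real.pi), abs_of_pos hnpos]
    rw [show (a.valMinAbs : ℝ) = ((vm a : ℤ) : ℝ) from rfl, hkabs]
  rw [hcos_eq]
  have h16 : (n : ℝ) ≤ (k : ℝ) * 16 := by exact_mod_cast h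
  have h2 : (k : ℝ) * 2 ≤ n := by
    have h0 : (vm a).natAbs ≤ n / 2 := ZMod.natAbs_valMinAbs_le a
    have : k * 2 ≤ n := by omega
    exact_mod_cast this
  have hcos : Real.cos (2 * Real.pi * k / n) ≤ Real.cos (Real.pi / 8) := by
    refine Real.cos_le_cos_of_nonneg_of_le_pi (by positivity) ?_ ?_
    · rw [div_le_iff₀ hnpos]; nlinarith [Real.pi_pos]
    · rw [le_div_iff₀ hnpos]; nlinarith [Real.pi_pos]
  linarith

/-- **The multiplier off the tiny window**: if not both `16|z̄ᵢ| < n` then `w(z) ≥ c₁`. [cite: Lee2013GL2Z, §2] -/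
theorem wt_ge_c₁ {z : ZMod n × ZMod n} (h : ¬ small 16 z) : c₁ ≤ wt z := by
  unfold small at h
  rw [not_and_or, not_lt, not_lt] at h
  unfold wt
  rcases h with h | h
  · exact (normSq_ψ_sub_one_ge h).trans (le_add_of_nonneg_right (sq_nonneg _))
  · exact (normSq_ψ_sub_one_ge h).trans (le_add_of_nonneg_left (sq_nonneg _))

/-! ### Transport to `ℤ²` -/

/-- The centred lift `ι(z) = (z̄₁, z̄₂)`. [folklore] -/
def ι (z : ZMod n × ZMod n) : ℤ × ℤ := (vm z.1, vm z.2)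

/-- The projection `π(w) = (w₁ mod n, w₂ mod n)`. [folklore] -/
def πz (w : ℤ × ℤ) : ZMod n × ZMod n := ((w.1 : ZMod n), (w.2 : ZMod n))

omit [NeZero n] in
/-- `π ∘ ι = id`. [folklore] -/
@[simp] theorem πz_ι (z : ZMod n × ZMod n) : πz (ι z) = z := by
  unfold πz ι vm; ext <;> simp [ZMod.coe_valMinAbs]

omit [NeZero n] in
/-- `ι` is injective. [folklore] -/
theorem ι_injective : Function.Injective (ι : ZMod n × ZMod n → ℤ × ℤ) := fun a b h => by
  simpa using congrArg (πz (n := n)) h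

/-- No wrap-around: the centred representative of a small integer is itself. [folklore] -/
theorem vm_intCast {y : ℤ} (h : y.natAbs * 2 < n) : vm ((y : ZMod n)) = y := by
  unfold vm
  rw [ZMod.valMinAbs_spec]
  refine ⟨rfl, ?_, ?_⟩
  · have : -(n : ℤ) < y * 2 := by omega
    exact this
  · have : y * 2 ≤ n := by omega
    exact this

/-- The inverse dual shears on the torus: `uS(a,b) = (a, b + a)`, `uT(a,b) = (a + b, b)`. [folklore] -/
def uS (z : ZMod n × ZMod n) : ZMod n × ZMod n := (z.1, z.2 + z.1)

/-- See `uS`. [folklore] -/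
def uT (z : ZMod n × ZMod n) : ZMod n × ZMod n := (z.1 + z.2, z.2)

omit [NeZero n] in
/-- `dS ∘ uS = id`. [folklore] -/
@[simp] theorem dS_uS (z : ZMod n × ZMod n) : dS (uS z) = z := by unfold dS uS; ext <;> simp
omit [NeZero n] in
/-- `uS ∘ dS = id`. [folklore] -/
@[simp] theorem uS_dS (z : ZMod n × ZMod n) : uS (dS z) = z := by unfold dS uS; ext <;> simp
omit [NeZero n] in
/-- `dT ∘ uT = id`. [folklore] -/
@[simp] theorem dT_uT (z : ZMod n × ZMod n) : dT (uT z) = z := by unfold dT uT; ext <;> simp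
omit [NeZero n] in
/-- `uT ∘ dT = id`. [folklore] -/
@[simp] theorem uT_dT (z : ZMod n × ZMod n) : uT (dT z) = z := by unfold dT uT; ext <;> simp

omit [NeZero n] in
/-- `π` intertwines `shS` and `uS`. [folklore] -/
theorem πz_shS (w : ℤ × ℤ) : πz (n := n) (shS w) = uS (πz w) := by unfold πz shS uS; ext <;> push_cast <;> ring
omit [NeZero n] in
/-- `π` intertwines `shT` and `uT`. [folklore] -/
theorem πz_shT (w : ℤ × ℤ) : πz (n := n) (shT w) = uT (πz w) := by unfold πz shT uT; ext <;> push_cast <;> ring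
omit [NeZero n] in
/-- `π` intertwines `shSi` and `dS`. [folklore] -/
theorem πz_shSi (w : ℤ × ℤ) : πz (n := n) (shSi w) = dS (πz w) := by unfold πz shSi dS; ext <;> push_cast <;> ring
omit [NeZero n] in
/-- `π` intertwines `shTi` and `dT`. [folklore] -/
theorem πz_shTi (w : ℤ × ℤ) : πz (n := n) (shTi w) = dT (πz w) := by unfold πz shTi dT; ext <;> push_cast <;> ring

/-- On the tiny window the shear `uS` does not wrap: `ι(uS z) = S(ι z)`. [cite: Lee2013GL2Z, §2 (the infinite graph inside the finite one)] -/
theorem ι_uS {z : ZMod n × ZMod n} (h : small 16 z) : ι (uS z) = shS (ι z) := by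
  unfold ι uS shS
  refine Prod.ext rfl ?_
  show vm (z.2 + z.1) = vm z.1 + vm z.2
  have e : z.2 + z.1 = (((vm z.1 + vm z.2 : ℤ)) : ZMod n) := by rw [Int.cast_add, ZMod.coe_valMinAbs, ZMod.coe_valMinAbs, add_comm]
  rw [e, vm_intCast]
  have := h.1; have := h.2; omega

/-- `ι(uT z) = T(ι z)` on the tiny window. [cite: Lee2013GL2Z, §2] -/
theorem ι_uT {z : ZMod n × ZMod n} (h : small 16 z) : ι (uT z) = shT (ι z) := by
  unfold ι uT shT
  refine Prod.ext ?_ rfl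
  show vm (z.1 + z.2) = vm z.1 + vm z.2
  have e : z.1 + z.2 = (((vm z.1 + vm z.2 : ℤ)) : ZMod n) := by rw [Int.cast_add, ZMod.coe_valMinAbs, ZMod.coe_valMinAbs]
  rw [e, vm_intCast]
  have := h.1; have := h.2; omega

/-- `ι(dS z) = S⁻¹(ι z)` on the tiny window. [cite: Lee2013GL2Z, §2] -/
theorem ι_dS {z : ZMod n × ZMod n} (h : small 16 z) : ι (dS z) = shSi (ι z) := by
  unfold ι dS shSi
  refine Prod.ext rfl ?_
  show vm (z.2 - z.1) = vm z.2 - vm z.1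
  have e : z.2 - z.1 = (((vm z.2 - vm z.1 : ℤ)) : ZMod n) := by rw [Int.cast_sub, ZMod.coe_valMinAbs, ZMod.coe_valMinAbs]
  rw [e, vm_intCast]
  have := h.1; have := h.2; omega

/-- `ι(dT z) = T⁻¹(ι z)` on the tiny window. [cite: Lee2013GL2Z, §2] -/
theorem ι_dT {z : ZMod n × ZMod n} (h : small 16 z) : ι (dT z) = shTi (ι z) := by
  unfold ι dT shTi
  refine Prod.ext ?_ rfl
  show vm (z.1 - z.2) = vm z.1 - vm z.2
  have e : z.1 - z.2 = (((vm z.1 - vm z.2 : ℤ)) : ZMod n) := by rw [Int.cast_sub, ZMod.coe_valMinAbs, ZMod.coe_valMinAbs]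
  rw [e, vm_intCast]
  have := h.1; have := h.2; omega

/-- The low-frequency window `R = {z ≠ 0 : small 8 z}`. [cite: Lee2013GL2Z, §2] -/
def R : Finset (ZMod n × ZMod n) := univ.filter fun z => z ≠ 0 ∧ small 8 z

/-- Tiny points of `R` stay in `R` under the four shears. [folklore] -/
theorem shear_mem_R {z : ZMod n × ZMod n} (hz : z ∈ R) (h : small 16 z) :
    uS z ∈ R ∧ uT z ∈ R ∧ dS z ∈ R ∧ dT z ∈ R := by
  rw [R, mem_filter] at hz
  obtain ⟨-, hz0, -⟩ := hz
  have h1 := h.1; have h2 := h.2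
  have key : ∀ y : ℤ, y.natAbs ≤ (vm z.1).natAbs + (vm z.2).natAbs → (vm ((y : ZMod n))).natAbs * 8 < n := fun y hy => by
    rw [vm_intCast (by omega)]; omega
  have hsum : (vm (z.2 + z.1)).natAbs * 8 < n := by
    have := key (vm z.2 + vm z.1) (by omega)
    simpa [vm, ZMod.coe_valMinAbs, add_comm] using this
  have hsum' : (vm (z.1 + z.2)).natAbs * 8 < n := by
    have := key (vm z.1 + vm z.2) (by omega)
    simpa [vm, ZMod.coe_valMinAbs] using this
  have hdif : (vm (z.2 - z.1)).natAbs * 8 < n := by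
    have := key (vm z.2 - vm z.1) (by omega)
    simpa [vm, ZMod.coe_valMinAbs] using this
  have hdif' : (vm (z.1 - z.2)).natAbs * 8 < n := by
    have := key (vm z.1 - vm z.2) (by omega)
    simpa [vm, ZMod.coe_valMinAbs] using this
  have h8 : small 8 z := h.mono (by norm_num)
  simp only [R, mem_filter, mem_univ, true_and, small, uS, uT, dS, dT]
  refine ⟨⟨fun he => hz0 ?_, h8.1, hsum⟩, ⟨fun he => hz0 ?_, hsum', h8.2⟩, ⟨fun he => hz0 ?_, h8.1, hdif⟩, ⟨fun he => hz0 ?_, hdif', h8.2⟩⟩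
  · have h1' : z.1 = 0 := (Prod.ext_iff.1 he).1
    have h2' : z.2 + z.1 = 0 := (Prod.ext_iff.1 he).2
    exact Prod.ext h1' (by rw [h1', add_zero] at h2'; exact h2')
  · have h2' : z.2 = 0 := (Prod.ext_iff.1 he).2
    have h1' : z.1 + z.2 = 0 := (Prod.ext_iff.1 he).1
    exact Prod.ext (by rw [h2', add_zero] at h1'; exact h1') h2'
  · have h1' : z.1 = 0 := (Prod.ext_iff.1 he).1
    have h2' : z.2 - z.1 = 0 := (Prod.ext_iff.1 he).2
    exact Prod.ext h1' (by rw [h1', sub_zero] at h2'; exact h2')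
  · have h2' : z.2 = 0 := (Prod.ext_iff.1 he).2
    have h1' : z.1 - z.2 = 0 := (Prod.ext_iff.1 he).1
    exact Prod.ext (by rw [h2', sub_zero] at h1'; exact h1') h2'

/-! ### The transported function and its energy -/

section transport

variable (g : ZMod n × ZMod n → ℝ)

/-- The canonical lattice points of `R`: `w = ι z` with `z ∈ R`. [folklore] -/
def Pw (w : ℤ × ℤ) : Prop := πz (n := n) w ∈ R ∧ ι (πz (n := n) w) = w

/-- Canonicity is decidable. [folklore] -/
instance (w : ℤ × ℤ) : Decidable (Pw (n := n) w) := by unfold Pw; infer_instance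

/-- `h = g ∘ π` on the canonical points of `R`, zero elsewhere. [cite: Lee2013GL2Z, §2 (restriction to the low frequencies)] -/
def hw (w : ℤ × ℤ) : ℝ := if Pw (n := n) w then g (πz (n := n) w) else 0

/-- Canonical points of `ι z`. [folklore] -/
theorem Pw_ι {z : ZMod n × ZMod n} (hz : z ∈ R) : Pw (n := n) (ι z) := by
  unfold Pw; rw [πz_ι]; exact ⟨hz, rfl⟩

/-- The box window `[-n, n]²`. [folklore] -/
def box : Finset (ℤ × ℤ) := (Icc (-(n : ℤ)) n) ×ˢ (Icc (-(n : ℤ)) n)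

/-- Canonical points lie in the half box. [folklore] -/
theorem abs_le_of_Pw {w : ℤ × ℤ} (h : Pw (n := n) w) : w.1.natAbs * 2 ≤ n ∧ w.2.natAbs * 2 ≤ n := by
  obtain ⟨-, he⟩ := h
  rw [← he]
  unfold ι
  have h1 : (vm (πz (n := n) w).1).natAbs ≤ n / 2 := ZMod.natAbs_valMinAbs_le (πz (n := n) w).1
  have h2 : (vm (πz (n := n) w).2).natAbs ≤ n / 2 := ZMod.natAbs_valMinAbs_le (πz (n := n) w).2
  constructor <;> omega

/-- The box is a window for `h`. [folklore] -/
theorem isWindow_hw : IsWindow (box (n := n)) (hw (n := n) g) := by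
  intro w hw'
  have hout : ∀ w' : ℤ × ℤ, Pw (n := n) w' → w'.1.natAbs * 2 ≤ n ∧ w'.2.natAbs * 2 ≤ n := fun w' h => abs_le_of_Pw h
  have hnot : ∀ w' : ℤ × ℤ, w'.1.natAbs ≤ n → w'.2.natAbs ≤ n → w' ∈ box (n := n) := fun w' h1 h2 => by
    simp only [box, mem_product, mem_Icc]; omega
  have ha : ¬ Pw (n := n) w := fun hP => by
    obtain ⟨h1, h2⟩ := hout w hP; exact hw' (hnot w (by omega) (by omega))
  have hb : ¬ Pw (n := n) (shS w) := fun hP => by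
    obtain ⟨h1, h2⟩ := hout _ hP; simp only [shS] at h1 h2; exact hw' (hnot w (by omega) (by omega))
  have hc : ¬ Pw (n := n) (shT w) := fun hP => by
    obtain ⟨h1, h2⟩ := hout _ hP; simp only [shT] at h1 h2; exact hw' (hnot w (by omega) (by omega))
  refine ⟨?_, ?_, ?_⟩ <;> simp only [hw, ha, hb, hc, if_false]

/-- `h ≥ 0` when `g ≥ 0`. [folklore] -/
theorem hw_nonneg (hg : ∀ z, 0 ≤ g z) (w : ℤ × ℤ) : 0 ≤ hw (n := n) g w := by
  unfold hw; split_ifs <;> [exact hg _; exact le_rfl]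

/-- `h(0) = 0` when `g(0) = 0`. [folklore] -/
theorem hw_zero (hg0 : g 0 = 0) : hw (n := n) g (0, 0) = 0 := by
  unfold hw; split_ifs
  · have : πz (n := n) ((0 : ℤ), (0 : ℤ)) = 0 := by unfold πz; simp
    rw [this, hg0]
  · rfl

/-- `∑_{w ∈ box} h² = ∑_{z ∈ R} g²`. [folklore] -/
theorem sum_hw_sq : ∑ w ∈ box (n := n), hw (n := n) g w ^ 2 = ∑ z ∈ R, g z ^ 2 := by
  classical
  have hwin := isWindow_hw (n := n) g
  -- restrict to canonical points, then reindex by `π`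
  rw [← sum_filter_add_sum_filter_not (box (n := n)) (Pw (n := n))]
  have h0 : ∑ w ∈ (box (n := n)).filter (fun w => ¬ Pw (n := n) w), hw (n := n) g w ^ 2 = 0 :=
    sum_eq_zero fun w hw' => by rw [mem_filter] at hw'; unfold hw; rw [if_neg hw'.2]; ring
  rw [h0, add_zero]
  refine sum_bij (fun w _ => πz (n := n) w) (fun w hw' => (mem_filter.1 hw').2.1) (fun w hw' w' hw'' h => ?_) (fun z hz => ?_) (fun w hw' => ?_)
  · have e1 := (mem_filter.1 hw').2.2
    have e2 := (mem_filter.1 hw'').2.2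
    rw [← e1, ← e2, h]
  · refine ⟨ι z, ?_, πz_ι z⟩
    rw [mem_filter]
    refine ⟨?_, Pw_ι hz⟩
    by_contra hb
    have := (hwin _ hb).1
    unfold hw at this
    rw [if_pos (Pw_ι hz), πz_ι] at this
    -- then `g z = 0`; but membership does not need positivity: put `ι z` in the box directly
    exact hb (by
      have hh := abs_le_of_Pw (Pw_ι (n := n) hz)
      simp only [box, mem_product, mem_Icc]; omega)
  · unfold hw; rw [if_pos (mem_filter.1 hw').2]

/-- The termwise bound on the `S`-energy of `h`. [cite: Lee2013GL2Z, §2] -/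
theorem hw_shS_sq_le (w : ℤ × ℤ) :
    (hw (n := n) g (shS w) - hw (n := n) g w) ^ 2 ≤
      (if Pw (n := n) w then (g (uS (πz (n := n) w)) - g (πz (n := n) w)) ^ 2 else 0) +
      (if Pw (n := n) w ∧ ¬ small 16 (πz (n := n) w) then g (πz (n := n) w) ^ 2 else 0) +
      (if Pw (n := n) (shS w) ∧ ¬ small 16 (πz (n := n) (shS w)) then g (πz (n := n) (shS w)) ^ 2 else 0) := by
  unfold hw
  by_cases h1 : Pw (n := n) w <;> by_cases h2 : Pw (n := n) (shS w)
  · -- both canonical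
    rw [if_pos h2, if_pos h1, if_pos h1, πz_shS]
    have : 0 ≤ (if Pw (n := n) w ∧ ¬ small 16 (πz (n := n) w) then g (πz (n := n) w) ^ 2 else 0) +
        (if Pw (n := n) (shS w) ∧ ¬ small 16 (uS (πz (n := n) w)) then g (uS (πz (n := n) w)) ^ 2 else 0) := by
      positivity
    linarith
  · -- `w` canonical, `S w` not: then `π w` is not tiny
    rw [if_neg h2, if_pos h1, if_pos h1]
    have hnt : ¬ small 16 (πz (n := n) w) := fun ht => h2 (by
      obtain ⟨hR, he⟩ := h1
      have hmem := (shear_mem_R hR ht).1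
      refine ⟨by rw [πz_shS]; exact hmem, ?_⟩
      rw [πz_shS, ι_uS ht, he])
    rw [if_pos ⟨h1, hnt⟩]
    have : 0 ≤ (if Pw (n := n) (shS w) ∧ ¬ small 16 (πz (n := n) (shS w)) then g (πz (n := n) (shS w)) ^ 2 else 0) := by positivity
    nlinarith [sq_nonneg (g (uS (πz (n := n) w)) - g (πz (n := n) w))]
  · -- `S w` canonical, `w` not: then `π (S w)` is not tiny
    rw [if_pos h2, if_neg h1, if_neg h1]
    have hnt : ¬ small 16 (πz (n := n) (shS w)) := fun ht => h1 (by
      obtain ⟨hR, he⟩ := h2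
      have hmem := (shear_mem_R hR ht).2.2.1
      have hw' : πz (n := n) w = dS (πz (n := n) (shS w)) := by rw [πz_shS, dS_uS]
      refine ⟨by rw [hw']; exact hmem, ?_⟩
      rw [hw', ι_dS ht, he, shSi_shS])
    rw [if_neg (fun h => h1 h.1), if_pos ⟨h2, hnt⟩]
    nlinarith
  · rw [if_neg h1, if_neg h2, if_neg h1, if_neg (fun h => h1 h.1), if_neg (fun h => h2 h.1)]; norm_num

/-- The termwise bound on the `T`-energy of `h`. [cite: Lee2013GL2Z, §2] -/
theorem hw_shT_sq_le (w : ℤ × ℤ) :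
    (hw (n := n) g (shT w) - hw (n := n) g w) ^ 2 ≤
      (if Pw (n := n) w then (g (uT (πz (n := n) w)) - g (πz (n := n) w)) ^ 2 else 0) +
      (if Pw (n := n) w ∧ ¬ small 16 (πz (n := n) w) then g (πz (n := n) w) ^ 2 else 0) +
      (if Pw (n := n) (shT w) ∧ ¬ small 16 (πz (n := n) (shT w)) then g (πz (n := n) (shT w)) ^ 2 else 0) := by
  unfold hw
  by_cases h1 : Pw (n := n) w <;> by_cases h2 : Pw (n := n) (shT w)
  · rw [if_pos h2, if_pos h1, if_pos h1, πz_shT]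
    have : 0 ≤ (if Pw (n := n) w ∧ ¬ small 16 (πz (n := n) w) then g (πz (n := n) w) ^ 2 else 0) +
        (if Pw (n := n) (shT w) ∧ ¬ small 16 (uT (πz (n := n) w)) then g (uT (πz (n := n) w)) ^ 2 else 0) := by
      positivity
    linarith
  · rw [if_neg h2, if_pos h1, if_pos h1]
    have hnt : ¬ small 16 (πz (n := n) w) := fun ht => h2 (by
      obtain ⟨hR, he⟩ := h1
      have hmem := (shear_mem_R hR ht).2.1
      refine ⟨by rw [πz_shT]; exact hmem, ?_⟩
      rw [πz_shT, ι_uT ht, he])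
    rw [if_pos ⟨h1, hnt⟩]
    have : 0 ≤ (if Pw (n := n) (shT w) ∧ ¬ small 16 (πz (n := n) (shT w)) then g (πz (n := n) (shT w)) ^ 2 else 0) := by positivity
    nlinarith [sq_nonneg (g (uT (πz (n := n) w)) - g (πz (n := n) w))]
  · rw [if_pos h2, if_neg h1, if_neg h1]
    have hnt : ¬ small 16 (πz (n := n) (shT w)) := fun ht => h1 (by
      obtain ⟨hR, he⟩ := h2
      have hmem := (shear_mem_R hR ht).2.2.2
      have hw' : πz (n := n) w = dT (πz (n := n) (shT w)) := by rw [πz_shT, dT_uT]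
      refine ⟨by rw [hw']; exact hmem, ?_⟩
      rw [hw', ι_dT ht, he, shTi_shT])
    rw [if_neg (fun h => h1 h.1), if_pos ⟨h2, hnt⟩]
    nlinarith
  · rw [if_neg h1, if_neg h2, if_neg h1, if_neg (fun h => h1 h.1), if_neg (fun h => h2 h.1)]; norm_num

/-- The band `B = R ∖ tiny`. [folklore] -/
def band : Finset (ZMod n × ZMod n) := R.filter fun z => ¬ small 16 z

/-- Summing an indicator-weighted function of `π w` over the canonical points of a subset of `R`. [folklore] -/
theorem sum_ite_Pw_le (Q : ZMod n × ZMod n → Prop) [DecidablePred Q] (φ : ZMod n × ZMod n → ℝ) (hφ : ∀ z, 0 ≤ φ z)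
    (m : ℤ × ℤ → ℤ × ℤ) (hm : Function.Injective m) :
    ∑ w ∈ box (n := n), (if Pw (n := n) (m w) ∧ Q (πz (n := n) (m w)) then φ (πz (n := n) (m w)) else 0) ≤
      ∑ z ∈ univ.filter Q, φ z := by
  classical
  rw [← sum_filter]
  calc ∑ w ∈ (box (n := n)).filter (fun w => Pw (n := n) (m w) ∧ Q (πz (n := n) (m w))), φ (πz (n := n) (m w))
      = ∑ z ∈ ((box (n := n)).filter fun w => Pw (n := n) (m w) ∧ Q (πz (n := n) (m w))).image fun w => πz (n := n) (m w), φ z := by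
        refine (sum_image fun w hw' w' hw'' h => ?_).symm
        rw [mem_coe, mem_filter] at hw' hw''
        have e1 := hw'.2.1.2
        have e2 := hw''.2.1.2
        exact hm (by rw [← e1, ← e2, h])
    _ ≤ ∑ z ∈ univ.filter Q, φ z := sum_le_sum_of_subset_of_nonneg (fun z hz => by
        rw [mem_image] at hz; obtain ⟨w, hw', rfl⟩ := hz
        rw [mem_filter] at hw' ⊢; exact ⟨mem_univ _, hw'.2.2⟩) fun z _ _ => hφ z

/-- Summing over canonical points of `R` is summing over `R` (equality form for `m = id`). [folklore] -/
theorem sum_ite_Pw_eq (φ : ZMod n × ZMod n → ℝ) :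
    ∑ w ∈ box (n := n), (if Pw (n := n) w then φ (πz (n := n) w) else 0) = ∑ z ∈ R, φ z := by
  classical
  rw [← sum_filter]
  refine sum_bij (fun w _ => πz (n := n) w) (fun w hw' => (mem_filter.1 hw').2.1) (fun w hw' w' hw'' h => ?_) (fun z hz => ?_) (fun w hw' => rfl)
  · have e1 := (mem_filter.1 hw').2.2
    have e2 := (mem_filter.1 hw'').2.2
    rw [← e1, ← e2, h]
  · refine ⟨ι z, ?_, πz_ι z⟩
    rw [mem_filter]
    refine ⟨?_, Pw_ι hz⟩
    have hh := abs_le_of_Pw (Pw_ι (n := n) hz)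
    simp only [box, mem_product, mem_Icc]; omega

/-- **The energy of the transported function**: at most the shear part of `N'(g)` plus four band sums.
[cite: Lee2013GL2Z, §2] -/
theorem energy_hw_le :
    energy (box (n := n)) (hw (n := n) g) ≤
      ∑ z, ((g (dS z) - g z) ^ 2 + (g (dT z) - g z) ^ 2) + 4 * ∑ z ∈ band (n := n), g z ^ 2 := by
  classical
  unfold energy
  have hS := fun w => hw_shS_sq_le (n := n) g w
  have hT := fun w => hw_shT_sq_le (n := n) g w
  have step1 : ∑ w ∈ box (n := n), ((hw (n := n) g (shS w) - hw (n := n) g w) ^ 2 + (hw (n := n) g (shT w) - hw (n := n) g w) ^ 2) ≤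
      ∑ w ∈ box (n := n), ((if Pw (n := n) w then (g (uS (πz (n := n) w)) - g (πz (n := n) w)) ^ 2 else 0) +
        (if Pw (n := n) w ∧ ¬ small 16 (πz (n := n) w) then g (πz (n := n) w) ^ 2 else 0) +
        (if Pw (n := n) (shS w) ∧ ¬ small 16 (πz (n := n) (shS w)) then g (πz (n := n) (shS w)) ^ 2 else 0) +
        ((if Pw (n := n) w then (g (uT (πz (n := n) w)) - g (πz (n := n) w)) ^ 2 else 0) +
        (if Pw (n := n) w ∧ ¬ small 16 (πz (n := n) w) then g (πz (n := n) w) ^ 2 else 0) +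
        (if Pw (n := n) (shT w) ∧ ¬ small 16 (πz (n := n) (shT w)) then g (πz (n := n) (shT w)) ^ 2 else 0))) :=
    sum_le_sum fun w _ => add_le_add (hS w) (hT w)
  refine step1.trans ?_
  simp only [sum_add_distrib]
  -- the shear parts
  have eS : ∑ w ∈ box (n := n), (if Pw (n := n) w then (g (uS (πz (n := n) w)) - g (πz (n := n) w)) ^ 2 else 0) ≤ ∑ z, (g (dS z) - g z) ^ 2 := by
    rw [sum_ite_Pw_eq (n := n) (fun z => (g (uS z) - g z) ^ 2)]
    calc ∑ z ∈ R, (g (uS z) - g z) ^ 2 ≤ ∑ z, (g (uS z) - g z) ^ 2 :=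
          sum_le_sum_of_subset_of_nonneg (subset_univ _) fun _ _ _ => sq_nonneg _
      _ = ∑ z, (g (dS z) - g z) ^ 2 := by
          refine Fintype.sum_equiv ⟨uS, dS, dS_uS, uS_dS⟩ _ _ fun z => ?_
          simp only [Equiv.coe_fn_mk, dS_uS]; ring
  have eT : ∑ w ∈ box (n := n), (if Pw (n := n) w then (g (uT (πz (n := n) w)) - g (πz (n := n) w)) ^ 2 else 0) ≤ ∑ z, (g (dT z) - g z) ^ 2 := by
    rw [sum_ite_Pw_eq (n := n) (fun z => (g (uT z) - g z) ^ 2)]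
    calc ∑ z ∈ R, (g (uT z) - g z) ^ 2 ≤ ∑ z, (g (uT z) - g z) ^ 2 :=
          sum_le_sum_of_subset_of_nonneg (subset_univ _) fun _ _ _ => sq_nonneg _
      _ = ∑ z, (g (dT z) - g z) ^ 2 := by
          refine Fintype.sum_equiv ⟨uT, dT, dT_uT, uT_dT⟩ _ _ fun z => ?_
          simp only [Equiv.coe_fn_mk, dT_uT]; ring
  -- the band parts: `Q = (· ∈ band)`, i.e. `∈ R ∧ ¬ tiny`; note `Pw w` gives `π w ∈ R`
  have hband : ∀ z, (z ∈ R ∧ ¬ small 16 z) ↔ z ∈ band (n := n) := fun z => by rw [band, mem_filter]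
  have eB : ∀ (m : ℤ × ℤ → ℤ × ℤ), Function.Injective m →
      ∑ w ∈ box (n := n), (if Pw (n := n) (m w) ∧ ¬ small 16 (πz (n := n) (m w)) then g (πz (n := n) (m w)) ^ 2 else 0) ≤
        ∑ z ∈ band (n := n), g z ^ 2 := by
    intro m hm
    have h := sum_ite_Pw_le (n := n) (fun z => z ∈ R ∧ ¬ small 16 z) (fun z => g z ^ 2) (fun z => sq_nonneg _) m hm
    have e1 : ∀ w, (Pw (n := n) (m w) ∧ ¬ small 16 (πz (n := n) (m w))) ↔
        (Pw (n := n) (m w) ∧ (πz (n := n) (m w) ∈ R ∧ ¬ small 16 (πz (n := n) (m w)))) := fun w =>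
      ⟨fun h => ⟨h.1, h.1.1, h.2⟩, fun h => ⟨h.1, h.2.2⟩⟩
    have e2 : (univ.filter fun z : ZMod n × ZMod n => z ∈ R ∧ ¬ small 16 z) = band (n := n) := by
      ext z; rw [mem_filter, band, mem_filter]; simp
    rw [e2] at h
    refine le_trans (le_of_eq (sum_congr rfl fun w _ => ?_)) h
    simp only [e1]
  have b1 := eB id Function.injective_id
  have b2 := eB shS shS_injective
  have b3 := eB shT shT_injective
  simp only [id_eq] at b1
  linarith

end transport

/-! ### The inequality -/

/-- **The low-frequency estimate of the Gabber–Galil proof** (discrete form): for `g ≥ 0` with `g(0) = 0`,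
`∑ g² ≤ (32/c₁) N'(g)`. [cite: Lee2013GL2Z, §2 (proof of Thm. 2.3)] -/
theorem sum_sq_le_mul_energyF (g : ZMod n × ZMod n → ℝ) (hg : ∀ z, 0 ≤ g z) (hg0 : g 0 = 0) :
    ∑ z, g z ^ 2 ≤ (32 / c₁) * energyF g := by
  classical
  -- split the mass: `R`, the rest (nonzero), and `0`
  have hsplit : ∑ z, g z ^ 2 = ∑ z ∈ R, g z ^ 2 + ∑ z ∈ univ.filter (fun z => z ≠ 0 ∧ ¬ small 8 z), g z ^ 2 := by
    rw [← sum_filter_add_sum_filter_not univ (fun z : ZMod n × ZMod n => z ≠ 0 ∧ small 8 z)]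
    congr 1
    rw [← sum_filter_add_sum_filter_not (univ.filter fun z : ZMod n × ZMod n => ¬ (z ≠ 0 ∧ small 8 z)) (fun z => z = 0)]
    have h0 : ∑ z ∈ (univ.filter fun z : ZMod n × ZMod n => ¬ (z ≠ 0 ∧ small 8 z)).filter (fun z => z = 0), g z ^ 2 = 0 :=
      sum_eq_zero fun z hz => by rw [mem_filter] at hz; rw [hz.2, hg0]; ring
    rw [h0, zero_add]
    congr 1
    ext z; simp only [mem_filter, mem_univ, true_and]; tauto
  -- the window part through `ℤ²`
  have hwin : ∑ z ∈ R, g z ^ 2 ≤ 8 * (∑ z, ((g (dS z) - g z) ^ 2 + (g (dT z) - g z) ^ 2) + 4 * ∑ z ∈ band (n := n), g z ^ 2) := by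
    rw [← sum_hw_sq (n := n) g]
    refine (sum_sq_le_eight_mul_energy _ _ (hw_nonneg g hg) (hw_zero g hg0) (isWindow_hw g)).trans ?_
    exact mul_le_mul_of_nonneg_left (energy_hw_le g) (by norm_num)
  -- the multiplier part
  have hmult : c₁ * (∑ z ∈ band (n := n), g z ^ 2 + ∑ z ∈ univ.filter (fun z => z ≠ 0 ∧ ¬ small 8 z), g z ^ 2) ≤ ∑ z, wt z * g z ^ 2 := by
    have hdisj : Disjoint (band (n := n)) (univ.filter fun z : ZMod n × ZMod n => z ≠ 0 ∧ ¬ small 8 z) := by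
      rw [disjoint_left]; intro z h1 h2
      rw [band, R, mem_filter, mem_filter] at h1; rw [mem_filter] at h2
      exact h2.2.2 h1.1.2.2
    rw [← sum_union hdisj, mul_sum]
    calc ∑ z ∈ band (n := n) ∪ univ.filter (fun z => z ≠ 0 ∧ ¬ small 8 z), c₁ * g z ^ 2
        ≤ ∑ z ∈ band (n := n) ∪ univ.filter (fun z => z ≠ 0 ∧ ¬ small 8 z), wt z * g z ^ 2 := by
          refine sum_le_sum fun z hz => mul_le_mul_of_nonneg_right ?_ (sq_nonneg _)
          rw [mem_union] at hz
          rcases hz with hz | hz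
          · rw [band, mem_filter] at hz; exact wt_ge_c₁ hz.2
          · rw [mem_filter] at hz; exact wt_ge_c₁ fun h => hz.2.2 (h.mono (by norm_num))
      _ ≤ ∑ z, wt z * g z ^ 2 := sum_le_sum_of_subset_of_nonneg (subset_univ _) fun z _ _ => mul_nonneg (wt_nonneg z) (sq_nonneg _)
  -- assemble
  have hc := c₁_pos
  have hc4 := c₁_le
  have hshear : 0 ≤ ∑ z : ZMod n × ZMod n, ((g (dS z) - g z) ^ 2 + (g (dT z) - g z) ^ 2) := sum_nonneg fun z _ => by positivity
  have hband0 : 0 ≤ ∑ z ∈ band (n := n), g z ^ 2 := sum_nonneg fun z _ => sq_nonneg _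
  have hout0 : 0 ≤ ∑ z ∈ univ.filter (fun z : ZMod n × ZMod n => z ≠ 0 ∧ ¬ small 8 z), g z ^ 2 := sum_nonneg fun z _ => sq_nonneg _
  have hE : energyF g = ∑ z, wt z * g z ^ 2 + ∑ z, ((g (dS z) - g z) ^ 2 + (g (dT z) - g z) ^ 2) := by
    unfold energyF; rw [← sum_add_distrib]; exact sum_congr rfl fun z _ => by ring
  rw [hsplit, hE]
  rw [div_mul_eq_mul_div, le_div_iff₀ hc]
  nlinarith [mul_le_mul_of_nonneg_left hwin hc.le, hmult, mul_nonneg hc.le hshear]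

end GabberGalil

end Literature.Computability.Complexity

end
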